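import Literature.NumberTheory.LFunctions.TwistedMomentSums
import HarnessLib

/-!
# Tail sums with a linear distance: `Σ_ν ν^{-1/2}/(|ν − ν₀| + σ) ≪ ν₀^{-1/2}(σ⁻¹ + log)`

Topic `Literature/NumberTheory/LFunctions`. Everything in this file is PROVED (no definitions, no
named facts).

In the cross terms of the Balasubramanian–Conrey–Heath-Brown mean square (named fact
`Literature.Barriers.RiemannHypothesis.BalasubramanianConreyHeathBrown1985_meanSquare`; plan in
`Literature/NumberTheory/LFunctions/BCHDiagonalReindex.lean`) every quadruple `(μ, ν, h, k)` carries a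
stationary-phase integral `∫_{T₁}^{2T} e^{it log(t/(ec))} dt`, `c = 2πμνh'/k'`, evaluated by the sharp
lemma `Literature.Analysis.Fourier.norm_logPhaseIntegral_sub_indicator_main_le_sharp`, whose error
`275 + 32·4T₁/(|c − T₁| + √(2T₁)) + 32·4T₁/(|2T − c| + √(2T₁))` has *linear* denominators in `c`,
hence in `ν`. Summing over `ν` with the weight `ν^{-1/2}` one meets (after dividing by the slope
`κ = 2πμh'/k'`) the sums of this file (Titchmarsh §9.22 meets instead `min(1/|log(ν/ν₀)|, √T)`, the
tree's `TwistedMoment.sum_rpow_div_max_log_le`; the linear form decays away from `ν₀` and loses no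
`√P`):

* `BCH.sum_one_div_abs_sub_add_le` — `Σ_{ν ≤ P} 1/(|ν − ν₀| + σ) ≤ 2/σ + 2(2 + log P + log ⌈ν₀⌉)`
  (`ν₀ ≥ 1`, `σ > 0`);
* `BCH.sum_Icc_rpow_neg_three_halves_le` — `Σ_{n₀ ≤ ν ≤ P} ν^{-3/2} ≤ 2 (n₀ − 1)^{-1/2}` (`n₀ ≥ 2`);
* `BCH.sum_rpow_div_abs_sub_add_le` — **the weighted tail sum**: for `ν₀ ≥ 1`, `σ > 0`,
  `Σ_{ν ≤ P} ν^{-1/2}/(|ν − ν₀| + σ) ≤ (13 + 3/σ + 3 log P + 3 log ⌈ν₀⌉)/√ν₀`.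

## References

* [Titchmarsh1986] E. C. Titchmarsh, *The Theory of the Riemann Zeta-Function*, 2nd ed. (1986), §9.22
  (the error sums of (9.22.2), here with the sharper linear kernel).
-/

noncomputable section

open Finset Real

namespace Literature.NumberTheory.LFunctions.BCH

open Literature.NumberTheory.LFunctions.TwistedMoment

/-! ### The unweighted sum -/

/-- At most two integers are within distance `< 1` of a real `ν₀ ≥ 0`. [folklore] -/
theorem card_filter_abs_sub_lt_one_le (P : ℕ) {ν₀ : ℝ} (hν₀ : 0 ≤ ν₀) :
    ((Finset.Icc 1 P).filter (fun ν : ℕ => |(ν : ℝ) - ν₀| < 1)).card ≤ 2 := by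
  have hsub : (Finset.Icc 1 P).filter (fun ν : ℕ => |(ν : ℝ) - ν₀| < 1) ⊆
      Finset.Icc ⌊ν₀⌋₊ (⌊ν₀⌋₊ + 1) := by
    intro ν hν
    rw [Finset.mem_filter] at hν
    have h := abs_lt.1 hν.2
    have hfl : (⌊ν₀⌋₊ : ℝ) ≤ ν₀ := Nat.floor_le hν₀
    have hfl1 : ν₀ < (⌊ν₀⌋₊ : ℝ) + 1 := Nat.lt_floor_add_one ν₀
    rw [Finset.mem_Icc]
    constructor
    · have : (⌊ν₀⌋₊ : ℝ) < ν + 1 := by linarith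
      exact_mod_cast Nat.lt_succ_iff.1 (by exact_mod_cast this : ⌊ν₀⌋₊ < ν + 1)
    · have : (ν : ℝ) < ⌊ν₀⌋₊ + 1 + 1 := by linarith
      have : ν < ⌊ν₀⌋₊ + 1 + 1 := by exact_mod_cast this
      omega
  exact (Finset.card_le_card hsub).trans (by rw [Nat.card_Icc]; omega)

/-- **`Σ_{ν ≤ P} 1/(|ν − ν₀| + σ) ≤ 2/σ + 2(2 + log P + log ⌈ν₀⌉)`** for `ν₀ ≥ 1`, `σ > 0`: the (at most
two) `ν` with `|ν − ν₀| < 1` give `≤ 2/σ`, the others two one-sided harmonic sums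
(`TwistedMoment.sum_filter_one_div_sub_le`). [folklore] -/
theorem sum_one_div_abs_sub_add_le (P : ℕ) {ν₀ σ : ℝ} (hν₀ : 1 ≤ ν₀) (hσ : 0 < σ) :
    ∑ ν ∈ Finset.Icc 1 P, 1 / (|(ν : ℝ) - ν₀| + σ) ≤
      2 / σ + 2 * (2 + Real.log P + Real.log ⌈ν₀⌉₊) := by
  have hν₀0 : 0 < ν₀ := by linarith
  -- pointwise split into near and one-sided far parts
  have hpt : ∀ ν ∈ Finset.Icc 1 P, 1 / (|(ν : ℝ) - ν₀| + σ) ≤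
      (if |(ν : ℝ) - ν₀| < 1 then 1 / σ else 0)
      + ((if 1 ≤ (ν : ℝ) - ν₀ then 1 / ((ν : ℝ) - ν₀) else 0)
        + (if 1 ≤ ν₀ - (ν : ℝ) then 1 / (ν₀ - (ν : ℝ)) else 0)) := by
    intro ν _
    have hn1 : 0 ≤ (if 1 ≤ (ν : ℝ) - ν₀ then 1 / ((ν : ℝ) - ν₀) else 0) := by
      split_ifs with h
      · have : 0 < (ν : ℝ) - ν₀ := by linarith
        positivity
      · exact le_rfl
    have hn2 : 0 ≤ (if 1 ≤ ν₀ - (ν : ℝ) then 1 / (ν₀ - (ν : ℝ)) else 0) := by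
      split_ifs with h
      · have : 0 < ν₀ - (ν : ℝ) := by linarith
        positivity
      · exact le_rfl
    have habs0 : 0 ≤ |(ν : ℝ) - ν₀| := abs_nonneg _
    by_cases hnear : |(ν : ℝ) - ν₀| < 1
    · rw [if_pos hnear]
      have h1 : 1 / (|(ν : ℝ) - ν₀| + σ) ≤ 1 / σ :=
        one_div_le_one_div_of_le hσ (by linarith)
      linarith
    · rw [if_neg hnear, zero_add]
      push Not at hnear
      have h1 : 1 / (|(ν : ℝ) - ν₀| + σ) ≤ 1 / |(ν : ℝ) - ν₀| :=
        one_div_le_one_div_of_le (by linarith) (by linarith)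
      rcases le_or_gt 0 ((ν : ℝ) - ν₀) with hsgn | hsgn
      · have ha1 : 1 ≤ (ν : ℝ) - ν₀ := by rwa [abs_of_nonneg hsgn] at hnear
        have hnot : ¬ (1 ≤ ν₀ - (ν : ℝ)) := by linarith
        rw [if_pos ha1, if_neg hnot, add_zero]
        exact h1.trans_eq (by rw [abs_of_nonneg hsgn])
      · have ha1 : 1 ≤ ν₀ - (ν : ℝ) := by rw [abs_of_neg hsgn] at hnear; linarith
        have hnot : ¬ (1 ≤ (ν : ℝ) - ν₀) := by linarith
        rw [if_neg hnot, if_pos ha1, zero_add]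
        exact h1.trans_eq (by rw [abs_of_neg hsgn, neg_sub])
  refine (Finset.sum_le_sum hpt).trans ?_
  rw [Finset.sum_add_distrib, Finset.sum_add_distrib]
  -- near terms
  have hnearS : ∑ ν ∈ Finset.Icc 1 P, (if |(ν : ℝ) - ν₀| < 1 then 1 / σ else 0) ≤ 2 / σ := by
    rw [← Finset.sum_filter, Finset.sum_const, nsmul_eq_mul]
    have hcard := card_filter_abs_sub_lt_one_le P hν₀0.le
    calc (((Finset.Icc 1 P).filter (fun ν : ℕ => |(ν : ℝ) - ν₀| < 1)).card : ℝ) * (1 / σ)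
        ≤ 2 * (1 / σ) := mul_le_mul_of_nonneg_right (by exact_mod_cast hcard) (by positivity)
      _ = 2 / σ := by ring
  -- far terms
  obtain ⟨hup, hdown⟩ := sum_filter_one_div_sub_le P hν₀
  rw [Finset.sum_filter] at hup hdown
  have hlogP : 0 ≤ Real.log (P : ℝ) := Real.log_natCast_nonneg P
  have hlogc : 0 ≤ Real.log (⌈ν₀⌉₊ : ℝ) := Real.log_natCast_nonneg _
  linarith

/-! ### The tail `Σ ν^{-3/2}` -/

/-- `ν^{-3/2} ≤ 2((ν−1)^{-1/2} − ν^{-1/2})` for `ν ≥ 2`. [folklore] -/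
theorem rpow_neg_three_halves_le_telescope {ν : ℝ} (hν : 2 ≤ ν) :
    ν ^ (-(3 / 2 : ℝ)) ≤ 2 * ((ν - 1) ^ (-(1 / 2 : ℝ)) - ν ^ (-(1 / 2 : ℝ))) := by
  have hν0 : 0 < ν := by linarith
  have hν1 : 0 < ν - 1 := by linarith
  set a := Real.sqrt ν with ha
  set b := Real.sqrt (ν - 1) with hb
  have ha0 : 0 < a := Real.sqrt_pos.2 hν0
  have hb0 : 0 < b := Real.sqrt_pos.2 hν1
  have ha2 : a ^ 2 = ν := Real.sq_sqrt hν0.le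
  have hb2 : b ^ 2 = ν - 1 := Real.sq_sqrt hν1.le
  have hba : b ≤ a := Real.sqrt_le_sqrt (by linarith)
  have e1 : ν ^ (-(1 / 2 : ℝ)) = a⁻¹ := by
    rw [Real.rpow_neg hν0.le, ← Real.sqrt_eq_rpow]
  have e2 : (ν - 1) ^ (-(1 / 2 : ℝ)) = b⁻¹ := by
    rw [Real.rpow_neg hν1.le, ← Real.sqrt_eq_rpow]
  have e3 : ν ^ (-(3 / 2 : ℝ)) = a⁻¹ ^ 3 := by
    rw [Real.rpow_neg hν0.le, show (3 / 2 : ℝ) = (1 / 2) * 3 by norm_num, Real.rpow_mul hν0.le,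
      ← Real.sqrt_eq_rpow, ← ha]
    rw [show ((3 : ℝ)) = ((3 : ℕ) : ℝ) by norm_num, Real.rpow_natCast, inv_pow]
  rw [e1, e2, e3]
  -- `1/a³ ≤ 2(1/b − 1/a)`, i.e. `b ≤ 2a²(a − b)`… with `a² − b² = 1`
  rw [inv_pow, show (b⁻¹ - a⁻¹) = (a - b) / (a * b) by field_simp]
  rw [inv_le_iff_one_le_mul₀ (by positivity)]
  have hab1 : (a - b) * (a + b) = 1 := by nlinarith
  have hapb : a + b ≤ 2 * a := by linarith
  have hab0 : 0 ≤ a - b := by linarith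
  -- `2 (a-b)/(ab) · a³ = 2 a² (a - b)/b ≥ 2a²(a-b)/a = 2a(a-b) ≥ (a+b)(a-b) = 1`
  have key : 1 ≤ 2 * ((a - b) / (a * b)) * a ^ 3 := by
    rw [show 2 * ((a - b) / (a * b)) * a ^ 3 = 2 * a ^ 2 * (a - b) / b by field_simp]
    rw [le_div_iff₀ hb0]
    nlinarith [mul_nonneg hab0 (sub_nonneg.2 hba), sq_nonneg a]
  linarith

/-- **Tail of `Σ ν^{-3/2}`**: `Σ_{n₀ ≤ ν ≤ P} ν^{-3/2} ≤ 2 (n₀ − 1)^{-1/2}` for `n₀ ≥ 2`. [folklore] -/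
theorem sum_Icc_rpow_neg_three_halves_le {n₀ : ℕ} (hn₀ : 2 ≤ n₀) (P : ℕ) :
    ∑ ν ∈ Finset.Icc n₀ P, (ν : ℝ) ^ (-(3 / 2 : ℝ)) ≤ 2 * ((n₀ : ℝ) - 1) ^ (-(1 / 2 : ℝ)) := by
  -- telescoping: the partial sums are `≤ 2((n₀−1)^{-1/2} − P^{-1/2})`
  have hn₀R : (0 : ℝ) ≤ (n₀ : ℝ) - 1 := by
    have : (2 : ℝ) ≤ n₀ := by exact_mod_cast hn₀
    linarith
  have key : ∀ P : ℕ, n₀ - 1 ≤ P →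
      ∑ ν ∈ Finset.Icc n₀ P, (ν : ℝ) ^ (-(3 / 2 : ℝ)) ≤
        2 * (((n₀ : ℝ) - 1) ^ (-(1 / 2 : ℝ)) - (P : ℝ) ^ (-(1 / 2 : ℝ))) := by
    intro P hP
    induction P, hP using Nat.le_induction with
    | base =>
      have he : Finset.Icc n₀ (n₀ - 1) = ∅ := Finset.Icc_eq_empty_of_lt (by omega)
      have hc : ((n₀ - 1 : ℕ) : ℝ) = (n₀ : ℝ) - 1 := by
        rw [Nat.cast_sub (by omega)]
        norm_num
      rw [he, Finset.sum_empty, hc, sub_self, mul_zero]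
    | succ P hP ih =>
      rw [Finset.sum_Icc_succ_top (by omega)]
      have h2 : (2 : ℝ) ≤ ((P + 1 : ℕ) : ℝ) := by exact_mod_cast (show 2 ≤ P + 1 by omega)
      have h := rpow_neg_three_halves_le_telescope h2
      push_cast at h ⊢
      rw [show (P : ℝ) + 1 - 1 = P by ring] at h
      linarith
  by_cases hP : n₀ - 1 ≤ P
  · have h := key P hP
    have : 0 ≤ (P : ℝ) ^ (-(1 / 2 : ℝ)) := by positivity
    linarith
  · have he : Finset.Icc n₀ P = ∅ := Finset.Icc_eq_empty_of_lt (by omega)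
    rw [he, Finset.sum_empty]
    exact mul_nonneg (by norm_num) (Real.rpow_nonneg hn₀R _)

/-! ### The weighted tail sum -/

/-- Pointwise split of `ν^{-1/2}/(|ν − ν₀| + σ)`: far (`ν ≤ ν₀/2`: `≤ 2ν^{-1/2}/ν₀`; `ν ≥ 2ν₀`:
`≤ 2ν^{-3/2}`), near (`|ν − ν₀| < 1`: `≤ √2/(σ√ν₀)`), middle (`≤ √2/(√ν₀ |ν − ν₀|)`). [folklore] -/
theorem rpow_div_abs_sub_add_le {ν ν₀ σ : ℝ} (hν : 1 ≤ ν) (hν₀ : 1 ≤ ν₀) (hσ : 0 < σ) :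
    ν ^ (-(1 / 2 : ℝ)) / (|ν - ν₀| + σ) ≤
      (if ν ≤ ν₀ / 2 then 2 * ν ^ (-(1 / 2 : ℝ)) / ν₀ else 0)
      + (if 2 * ν₀ ≤ ν then 2 * ν ^ (-(3 / 2 : ℝ)) else 0)
      + (if |ν - ν₀| < 1 then Real.sqrt 2 / (σ * Real.sqrt ν₀) else 0)
      + (if ν₀ / 2 < ν ∧ ν < 2 * ν₀ ∧ 1 ≤ |ν - ν₀| then Real.sqrt 2 / (Real.sqrt ν₀ * |ν - ν₀|)
          else 0) := by
  have hν0 : 0 < ν := by linarith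
  have hν₀0 : 0 < ν₀ := by linarith
  have hsν₀ : 0 < Real.sqrt ν₀ := Real.sqrt_pos.2 hν₀0
  have hrp : ν ^ (-(1 / 2 : ℝ)) = (Real.sqrt ν)⁻¹ := by
    rw [Real.rpow_neg hν0.le, ← Real.sqrt_eq_rpow]
  have hrp0 : 0 < ν ^ (-(1 / 2 : ℝ)) := by positivity
  have habs0 : 0 ≤ |ν - ν₀| := abs_nonneg _
  have hden : 0 < |ν - ν₀| + σ := by linarith
  -- non-negativity of the four pieces
  have n1 : 0 ≤ (if ν ≤ ν₀ / 2 then 2 * ν ^ (-(1 / 2 : ℝ)) / ν₀ else 0) := by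
    split_ifs <;> positivity
  have n2 : 0 ≤ (if 2 * ν₀ ≤ ν then 2 * ν ^ (-(3 / 2 : ℝ)) else 0) := by
    split_ifs <;> positivity
  have n3 : 0 ≤ (if |ν - ν₀| < 1 then Real.sqrt 2 / (σ * Real.sqrt ν₀) else 0) := by
    split_ifs <;> positivity
  have n4 : 0 ≤ (if ν₀ / 2 < ν ∧ ν < 2 * ν₀ ∧ 1 ≤ |ν - ν₀| then
      Real.sqrt 2 / (Real.sqrt ν₀ * |ν - ν₀|) else 0) := by
    split_ifs with h
    · have : 0 < |ν - ν₀| := by linarith [h.2.2]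
      positivity
    · exact le_rfl
  -- in the middle/near range, `ν^{-1/2} ≤ √2/√ν₀`
  have hmidrp : ν₀ / 2 < ν → ν ^ (-(1 / 2 : ℝ)) ≤ Real.sqrt 2 / Real.sqrt ν₀ := by
    intro h
    rw [hrp, inv_le_iff_one_le_mul₀ (Real.sqrt_pos.2 hν0), div_mul_eq_mul_div, le_div_iff₀ hsν₀,
      one_mul, ← Real.sqrt_mul (by norm_num : (0:ℝ) ≤ 2)]
    exact Real.sqrt_le_sqrt (by linarith)
  by_cases hlow : ν ≤ ν₀ / 2
  · -- far, low
    rw [if_pos hlow]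
    have h1 : ν₀ / 2 ≤ |ν - ν₀| := by
      rw [abs_of_nonpos (by linarith)]; linarith
    have : ν ^ (-(1 / 2 : ℝ)) / (|ν - ν₀| + σ) ≤ 2 * ν ^ (-(1 / 2 : ℝ)) / ν₀ := by
      rw [div_le_div_iff₀ hden hν₀0]
      nlinarith
    linarith
  · rw [if_neg hlow]
    push Not at hlow
    by_cases hhigh : 2 * ν₀ ≤ ν
    · -- far, high
      rw [if_pos hhigh]
      have h1 : ν / 2 ≤ |ν - ν₀| := by
        rw [abs_of_nonneg (by linarith)]; linarith
      have e : ν ^ (-(3 / 2 : ℝ)) = ν ^ (-(1 / 2 : ℝ)) / ν := by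
        rw [show (-(3 / 2 : ℝ)) = -(1 / 2) - 1 by norm_num, Real.rpow_sub hν0, Real.rpow_one]
      have : ν ^ (-(1 / 2 : ℝ)) / (|ν - ν₀| + σ) ≤ 2 * ν ^ (-(3 / 2 : ℝ)) := by
        rw [e, mul_div_assoc', div_le_div_iff₀ hden hν0]
        nlinarith
      linarith
    · rw [if_neg hhigh]
      push Not at hhigh
      have hrp2 := hmidrp hlow
      by_cases hnear : |ν - ν₀| < 1
      · -- near
        rw [if_pos hnear]
        have hnot : ¬ (ν₀ / 2 < ν ∧ ν < 2 * ν₀ ∧ 1 ≤ |ν - ν₀|) := fun h => by linarith [h.2.2]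
        rw [if_neg hnot]
        have : ν ^ (-(1 / 2 : ℝ)) / (|ν - ν₀| + σ) ≤ Real.sqrt 2 / (σ * Real.sqrt ν₀) := by
          calc ν ^ (-(1 / 2 : ℝ)) / (|ν - ν₀| + σ) ≤ ν ^ (-(1 / 2 : ℝ)) / σ :=
                div_le_div_of_nonneg_left hrp0.le hσ (by linarith)
            _ ≤ (Real.sqrt 2 / Real.sqrt ν₀) / σ := div_le_div_of_nonneg_right hrp2 hσ.le
            _ = Real.sqrt 2 / (σ * Real.sqrt ν₀) := by rw [div_div, mul_comm]
        linarith
      · -- middle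
        rw [if_neg hnear]
        push Not at hnear
        have hmid : ν₀ / 2 < ν ∧ ν < 2 * ν₀ ∧ 1 ≤ |ν - ν₀| := ⟨hlow, hhigh, hnear⟩
        rw [if_pos hmid]
        have hpos : 0 < |ν - ν₀| := by linarith
        have : ν ^ (-(1 / 2 : ℝ)) / (|ν - ν₀| + σ) ≤ Real.sqrt 2 / (Real.sqrt ν₀ * |ν - ν₀|) := by
          calc ν ^ (-(1 / 2 : ℝ)) / (|ν - ν₀| + σ) ≤ ν ^ (-(1 / 2 : ℝ)) / |ν - ν₀| :=
                div_le_div_of_nonneg_left hrp0.le hpos (by linarith)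
            _ ≤ (Real.sqrt 2 / Real.sqrt ν₀) / |ν - ν₀| := div_le_div_of_nonneg_right hrp2 hpos.le
            _ = Real.sqrt 2 / (Real.sqrt ν₀ * |ν - ν₀|) := by rw [div_div]
        linarith

/-- **The weighted tail sum.** For `ν₀ ≥ 1`, `σ > 0` and every `P`:
`Σ_{ν=1}^{P} ν^{-1/2}/(|ν − ν₀| + σ) ≤ (13 + 3/σ + 3 log P + 3 log ⌈ν₀⌉)/√ν₀`
(far terms `O(ν₀^{-1/2})` by `Σ_{ν ≤ ν₀/2} ν^{-1/2} ≤ 2√(ν₀/2)` and the `ν^{-3/2}` tail; near terms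
`O(1/(σ√ν₀))`; middle terms `O(ν₀^{-1/2} log)` by the one-sided harmonic sums). [cite: Titchmarsh1986, §9.22] -/
theorem sum_rpow_div_abs_sub_add_le (P : ℕ) {ν₀ σ : ℝ} (hν₀ : 1 ≤ ν₀) (hσ : 0 < σ) :
    ∑ ν ∈ Finset.Icc 1 P, (ν : ℝ) ^ (-(1 / 2 : ℝ)) / (|(ν : ℝ) - ν₀| + σ) ≤
      (13 + 3 / σ + 3 * Real.log P + 3 * Real.log ⌈ν₀⌉₊) / Real.sqrt ν₀ := by
  have hν₀0 : 0 < ν₀ := by linarith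
  have hsν₀ : 0 < Real.sqrt ν₀ := Real.sqrt_pos.2 hν₀0
  have hs2 : Real.sqrt 2 ≤ 3 / 2 := by
    rw [Real.sqrt_le_left (by norm_num)]; norm_num
  have hs2' : 0 < Real.sqrt 2 := Real.sqrt_pos.2 (by norm_num)
  have hpt : ∀ ν ∈ Finset.Icc 1 P, (ν : ℝ) ^ (-(1 / 2 : ℝ)) / (|(ν : ℝ) - ν₀| + σ) ≤
      (if (ν : ℝ) ≤ ν₀ / 2 then 2 * (ν : ℝ) ^ (-(1 / 2 : ℝ)) / ν₀ else 0)
      + (if 2 * ν₀ ≤ ν then 2 * (ν : ℝ) ^ (-(3 / 2 : ℝ)) else 0)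
      + (if |(ν : ℝ) - ν₀| < 1 then Real.sqrt 2 / (σ * Real.sqrt ν₀) else 0)
      + (if ν₀ / 2 < (ν : ℝ) ∧ (ν : ℝ) < 2 * ν₀ ∧ 1 ≤ |(ν : ℝ) - ν₀| then
          Real.sqrt 2 / (Real.sqrt ν₀ * |(ν : ℝ) - ν₀|) else 0) :=
    fun ν hν => rpow_div_abs_sub_add_le (by exact_mod_cast (Finset.mem_Icc.1 hν).1) hν₀ hσ
  refine (Finset.sum_le_sum hpt).trans ?_
  rw [Finset.sum_add_distrib, Finset.sum_add_distrib, Finset.sum_add_distrib]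
  -- (A1) `ν ≤ ν₀/2`: `Σ ν^{-1/2} ≤ 2√⌊ν₀/2⌋ ≤ 2√(ν₀/2)`, so the part is `≤ 4√(ν₀/2)/ν₀ = 2√2/√ν₀`
  have hA1 : ∑ ν ∈ Finset.Icc 1 P, (if (ν : ℝ) ≤ ν₀ / 2 then 2 * (ν : ℝ) ^ (-(1 / 2 : ℝ)) / ν₀ else 0)
      ≤ 3 / Real.sqrt ν₀ := by
    rw [← Finset.sum_filter]
    have hsub : (Finset.Icc 1 P).filter (fun ν : ℕ => (ν : ℝ) ≤ ν₀ / 2) ⊆ Finset.Icc 1 ⌊ν₀ / 2⌋₊ := by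
      intro ν hν
      rw [Finset.mem_filter, Finset.mem_Icc] at hν
      rw [Finset.mem_Icc]
      exact ⟨hν.1.1, Nat.le_floor hν.2⟩
    have hnn : ∀ ν ∈ Finset.Icc 1 ⌊ν₀ / 2⌋₊, 0 ≤ 2 * (ν : ℝ) ^ (-(1 / 2 : ℝ)) / ν₀ :=
      fun ν _ => by positivity
    calc ∑ ν ∈ (Finset.Icc 1 P).filter (fun ν : ℕ => (ν : ℝ) ≤ ν₀ / 2), 2 * (ν : ℝ) ^ (-(1 / 2 : ℝ)) / ν₀
        ≤ ∑ ν ∈ Finset.Icc 1 ⌊ν₀ / 2⌋₊, 2 * (ν : ℝ) ^ (-(1 / 2 : ℝ)) / ν₀ :=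
          Finset.sum_le_sum_of_subset_of_nonneg hsub fun ν hν _ => hnn ν hν
      _ = (2 / ν₀) * ∑ ν ∈ Finset.Icc 1 ⌊ν₀ / 2⌋₊, (ν : ℝ) ^ (-(1 / 2 : ℝ)) := by
          rw [Finset.mul_sum]
          refine Finset.sum_congr rfl fun ν _ => ?_
          ring
      _ ≤ (2 / ν₀) * (2 * Real.sqrt (⌊ν₀ / 2⌋₊ : ℕ)) :=
          mul_le_mul_of_nonneg_left (sum_Icc_rpow_neg_half_le _) (by positivity)
      _ ≤ (2 / ν₀) * (2 * Real.sqrt (ν₀ / 2)) := by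
          gcongr
          exact Nat.floor_le (by positivity)
      _ = 2 * Real.sqrt 2 / Real.sqrt ν₀ := by
          have e : Real.sqrt (ν₀ / 2) = Real.sqrt ν₀ / Real.sqrt 2 := Real.sqrt_div hν₀0.le 2
          rw [e]
          have h2 : Real.sqrt 2 ^ 2 = 2 := Real.sq_sqrt (by norm_num)
          have hν2 : Real.sqrt ν₀ ^ 2 = ν₀ := Real.sq_sqrt hν₀0.le
          field_simp
          nlinarith [h2, hν2]
      _ ≤ 3 / Real.sqrt ν₀ := div_le_div_of_nonneg_right (by nlinarith) hsν₀.le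
  -- (A2) `ν ≥ 2ν₀`: the `ν^{-3/2}` tail from `n₀ = ⌈2ν₀⌉ ≥ 2`, `≤ 2·2(n₀−1)^{-1/2} ≤ 4/√ν₀`
  have hA2 : ∑ ν ∈ Finset.Icc 1 P, (if 2 * ν₀ ≤ ν then 2 * (ν : ℝ) ^ (-(3 / 2 : ℝ)) else 0)
      ≤ 4 / Real.sqrt ν₀ := by
    rw [← Finset.sum_filter]
    set n₀ : ℕ := ⌈2 * ν₀⌉₊ with hn₀
    have hn₀2 : 2 ≤ n₀ := by
      rw [hn₀]
      have : (2 : ℝ) ≤ 2 * ν₀ := by linarith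
      exact_mod_cast (show ((2 : ℕ) : ℝ) ≤ ⌈2 * ν₀⌉₊ from
        le_trans (by exact_mod_cast this) (Nat.le_ceil _))
    have hsub : (Finset.Icc 1 P).filter (fun ν : ℕ => 2 * ν₀ ≤ ν) ⊆ Finset.Icc n₀ P := by
      intro ν hν
      rw [Finset.mem_filter, Finset.mem_Icc] at hν
      rw [Finset.mem_Icc]
      exact ⟨Nat.ceil_le.2 hν.2, hν.1.2⟩
    have hnn : ∀ ν ∈ Finset.Icc n₀ P, 0 ≤ 2 * (ν : ℝ) ^ (-(3 / 2 : ℝ)) := fun ν _ => by positivity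
    have htail := sum_Icc_rpow_neg_three_halves_le hn₀2 P
    have hmono : ((n₀ : ℝ) - 1) ^ (-(1 / 2 : ℝ)) ≤ ν₀ ^ (-(1 / 2 : ℝ)) := by
      apply Real.rpow_le_rpow_of_nonpos hν₀0 _ (by norm_num)
      have : 2 * ν₀ ≤ n₀ := Nat.le_ceil _
      linarith
    have hrp : ν₀ ^ (-(1 / 2 : ℝ)) = 1 / Real.sqrt ν₀ := by
      rw [Real.rpow_neg hν₀0.le, ← Real.sqrt_eq_rpow, one_div]
    calc ∑ ν ∈ (Finset.Icc 1 P).filter (fun ν : ℕ => 2 * ν₀ ≤ ν), 2 * (ν : ℝ) ^ (-(3 / 2 : ℝ))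
        ≤ ∑ ν ∈ Finset.Icc n₀ P, 2 * (ν : ℝ) ^ (-(3 / 2 : ℝ)) :=
          Finset.sum_le_sum_of_subset_of_nonneg hsub fun ν hν _ => hnn ν hν
      _ = 2 * ∑ ν ∈ Finset.Icc n₀ P, (ν : ℝ) ^ (-(3 / 2 : ℝ)) := by rw [Finset.mul_sum]
      _ ≤ 2 * (2 * ((n₀ : ℝ) - 1) ^ (-(1 / 2 : ℝ))) := by linarith
      _ ≤ 2 * (2 * ν₀ ^ (-(1 / 2 : ℝ))) := by linarith
      _ = 4 / Real.sqrt ν₀ := by rw [hrp]; ring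
  -- (B) near terms: at most two, each `√2/(σ√ν₀)`
  have hB : ∑ ν ∈ Finset.Icc 1 P, (if |(ν : ℝ) - ν₀| < 1 then Real.sqrt 2 / (σ * Real.sqrt ν₀) else 0)
      ≤ 3 / σ / Real.sqrt ν₀ := by
    rw [← Finset.sum_filter, Finset.sum_const, nsmul_eq_mul]
    have hcard := card_filter_abs_sub_lt_one_le P hν₀0.le
    calc (((Finset.Icc 1 P).filter (fun ν : ℕ => |(ν : ℝ) - ν₀| < 1)).card : ℝ) *
          (Real.sqrt 2 / (σ * Real.sqrt ν₀))
        ≤ 2 * (Real.sqrt 2 / (σ * Real.sqrt ν₀)) :=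
          mul_le_mul_of_nonneg_right (by exact_mod_cast hcard) (by positivity)
      _ = (2 * Real.sqrt 2) / σ / Real.sqrt ν₀ := by
          field_simp
      _ ≤ 3 / σ / Real.sqrt ν₀ := by
          apply div_le_div_of_nonneg_right _ hsν₀.le
          exact div_le_div_of_nonneg_right (by nlinarith) hσ.le
  -- (C) middle terms: one-sided harmonic sums
  have hC : ∑ ν ∈ Finset.Icc 1 P, (if ν₀ / 2 < (ν : ℝ) ∧ (ν : ℝ) < 2 * ν₀ ∧ 1 ≤ |(ν : ℝ) - ν₀| then
          Real.sqrt 2 / (Real.sqrt ν₀ * |(ν : ℝ) - ν₀|) else 0)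
      ≤ 3 * (2 + Real.log P + Real.log ⌈ν₀⌉₊) / Real.sqrt ν₀ := by
    obtain ⟨hup, hdown⟩ := sum_filter_one_div_sub_le P hν₀
    have hpt2 : ∀ ν ∈ Finset.Icc 1 P,
        (if ν₀ / 2 < (ν : ℝ) ∧ (ν : ℝ) < 2 * ν₀ ∧ 1 ≤ |(ν : ℝ) - ν₀| then
          Real.sqrt 2 / (Real.sqrt ν₀ * |(ν : ℝ) - ν₀|) else 0) ≤
        (Real.sqrt 2 / Real.sqrt ν₀) * ((if 1 ≤ (ν : ℝ) - ν₀ then 1 / ((ν : ℝ) - ν₀) else 0)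
          + (if 1 ≤ ν₀ - (ν : ℝ) then 1 / (ν₀ - (ν : ℝ)) else 0)) := by
      intro ν _
      have hn1 : 0 ≤ (if 1 ≤ (ν : ℝ) - ν₀ then 1 / ((ν : ℝ) - ν₀) else 0) := by
        split_ifs with h
        · have : 0 < (ν : ℝ) - ν₀ := by linarith
          positivity
        · exact le_rfl
      have hn2 : 0 ≤ (if 1 ≤ ν₀ - (ν : ℝ) then 1 / (ν₀ - (ν : ℝ)) else 0) := by
        split_ifs with h
        · have : 0 < ν₀ - (ν : ℝ) := by linarith
          positivity
        · exact le_rfl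
      by_cases hmid : ν₀ / 2 < (ν : ℝ) ∧ (ν : ℝ) < 2 * ν₀ ∧ 1 ≤ |(ν : ℝ) - ν₀|
      · rw [if_pos hmid]
        obtain ⟨-, -, habs⟩ := hmid
        rcases le_or_gt 0 ((ν : ℝ) - ν₀) with hsgn | hsgn
        · have ha1 : 1 ≤ (ν : ℝ) - ν₀ := by rwa [abs_of_nonneg hsgn] at habs
          have hnot : ¬ (1 ≤ ν₀ - (ν : ℝ)) := by linarith
          rw [abs_of_nonneg hsgn, if_pos ha1, if_neg hnot, add_zero, div_mul_eq_div_div, mul_one_div]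
        · have ha1 : 1 ≤ ν₀ - (ν : ℝ) := by rw [abs_of_neg hsgn] at habs; linarith
          have hnot : ¬ (1 ≤ (ν : ℝ) - ν₀) := by linarith
          rw [abs_of_neg hsgn, if_neg hnot, if_pos ha1, zero_add, neg_sub, div_mul_eq_div_div,
            mul_one_div]
      · rw [if_neg hmid]
        exact mul_nonneg (by positivity) (add_nonneg hn1 hn2)
    refine (Finset.sum_le_sum hpt2).trans ?_
    rw [← Finset.mul_sum, Finset.sum_add_distrib, ← Finset.sum_filter, ← Finset.sum_filter]
    have hlog0 : 0 ≤ Real.log (P : ℝ) := Real.log_natCast_nonneg P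
    have hlog1 : 0 ≤ Real.log (⌈ν₀⌉₊ : ℝ) := Real.log_natCast_nonneg _
    calc (Real.sqrt 2 / Real.sqrt ν₀) *
          (∑ ν ∈ (Finset.Icc 1 P).filter (fun ν : ℕ => 1 ≤ (ν : ℝ) - ν₀), 1 / ((ν : ℝ) - ν₀)
            + ∑ ν ∈ (Finset.Icc 1 P).filter (fun ν : ℕ => 1 ≤ ν₀ - (ν : ℝ)), 1 / (ν₀ - (ν : ℝ)))
        ≤ (Real.sqrt 2 / Real.sqrt ν₀) * (2 * (1 + Real.log P) + 2 * (1 + Real.log ⌈ν₀⌉₊)) :=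
          mul_le_mul_of_nonneg_left (add_le_add hup hdown) (by positivity)
      _ = (2 * Real.sqrt 2) * (2 + Real.log P + Real.log ⌈ν₀⌉₊) / Real.sqrt ν₀ := by ring
      _ ≤ 3 * (2 + Real.log P + Real.log ⌈ν₀⌉₊) / Real.sqrt ν₀ := by
          apply div_le_div_of_nonneg_right _ hsν₀.le
          apply mul_le_mul_of_nonneg_right (by nlinarith) (by linarith)
  -- combine
  have e : (13 + 3 / σ + 3 * Real.log P + 3 * Real.log ⌈ν₀⌉₊) / Real.sqrt ν₀ =
      3 / Real.sqrt ν₀ + 4 / Real.sqrt ν₀ + 3 / σ / Real.sqrt ν₀ +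
        3 * (2 + Real.log P + Real.log ⌈ν₀⌉₊) / Real.sqrt ν₀ := by
    field_simp
    ring
  rw [e]
  linarith

end Literature.NumberTheory.LFunctions.BCH
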